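import Literature.AnabelianGeometry.EtaleTheta.Discharge.Sec3RootLawNoGoTempered

/-!
# [EtTh] §3 census laws AT THE TEMPERED MODELS OF RECORD: A9 `BaseInj` HOLDS (all three monoid types), A10 `BaseRootLaw`
# FAILS (type `ℤ`) — the NV register entries for the named predicates of `TemperedFrobenioidLaws.lean`

S. Mochizuki, *The étale theta function …*, Publ. RIMS **45** (2009) [MochizukiEtTh2009], §3 Def. 3.3 (iii) p.73 («the
assignments … determine functors»: transition maps of `B₀` are inclusions of invariants), Def. 3.6 (i)(ii) pp.76–77,
Prop. 4.2 (iii) p.89 [cite: MochizukiEtTh2009, Def 3.6 p.77].  abc-iut cell, layer L2; seat abc-iut-L2-t3 (gen 5), owner of the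
census predicates `TemperedFrobenioid.BaseInj` (A9) / `BaseRootLaw` (A10) (p443354).  PROOF-ONLY (0 defs); inputs BY NAME:
abc-iut-w6-d048's `DivisorMonoids.ofGaloisActionTempered` + `…_ofRlf{Z,Q,R}Weak_hBinj` (p449586); this seat's
`not_baseRootLaw_top_tempered` (p453110); nothing landed is edited.
* `TemperedFrobenioid.baseInj_ofRlfZWeak_ofGaloisActionTempered` / `_ofRlfQWeak_` / `_ofRlfRWeak_` — **A9 HOLDS at every tempered
  Frobenioid (any base category / base functor) over the tempered v1 data, for `Λ = ℤ, ℚ, ℝ`** (even the `D₀`-wide `hBinj`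
  holds there: connected tempered coverings have surjective transition maps).
* `TemperedFrobenioid.baseInj_and_not_baseRootLaw_ofGaloisActionTempered` — at `Λ = ℤ`: A9 ✓ and A10 ✗ SIMULTANEOUSLY (the
  two census laws are independent in the strong sense: the genuine-vocabulary models satisfy the injectivity law and refute
  the root law — F-L2t3g5-1).
HONEST FRAMING: NV/register bookkeeping over constructed models; typed ≠ proved; nothing here bears on [IUTchIII] Cor. 3.12.
-/

noncomputable section

namespace Literature.AnabelianGeometry.EtaleTheta

open CategoryTheory Opposite Function Literature.AlgebraicGeometry.Frobenioids Literature.AnabelianGeometry.SemiGraphs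

universe u u₀ v₀

namespace TemperedFrobenioid

variable {Γ : Type u} [Group Γ] [TopologicalSpace Γ] {Z : LogDivisorModel.{u}} (A : Z.GaloisAction Γ) (hZ : Z.CuspLaws)
  (hpf : ∀ Y : (ConnectedPart (BTemp Γ))ᵒᵖ, IsPerfFactorialCof ((DivisorMonoids.ofGaloisActionTempered A hZ).Φ₀.obj Y))
  {D : Type u₀} [Category.{v₀} D] {VD : FrdICatStub.{u₀, v₀, u} D}

/-- **A9 `BaseInj` HOLDS at every tempered Frobenioid of monoid type `ℤ` over the tempered v1 data** (abc-iut-w6-d048's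
`ofGaloisActionTempered_ofRlfZWeak_hBinj` BY NAME). [cite: MochizukiEtTh2009, Def 3.3 (iii) p.73] -/
theorem baseInj_ofRlfZWeak_ofGaloisActionTempered
    (tf : TemperedFrobenioid (RealifiedDivisorMonoids.ofRlfZWeak (DivisorMonoids.ofGaloisActionTempered A hZ) hpf) D VD) :
    tf.BaseInj :=
  BaseInj.of_hBinj tf fun g => DivisorMonoids.ofGaloisActionTempered_ofRlfZWeak_hBinj A hZ hpf g

/-- **A9 at monoid type `ℚ`** over the tempered v1 data. [cite: MochizukiEtTh2009, Def 3.3 (iii) p.73] -/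
theorem baseInj_ofRlfQWeak_ofGaloisActionTempered
    (tf : TemperedFrobenioid (RealifiedDivisorMonoids.ofRlfQWeak (DivisorMonoids.ofGaloisActionTempered A hZ) hpf) D VD) :
    tf.BaseInj :=
  BaseInj.of_hBinj tf fun g => DivisorMonoids.ofGaloisActionTempered_ofRlfQWeak_hBinj A hZ hpf g

/-- **A9 at monoid type `ℝ`** over the tempered v1 data. [cite: MochizukiEtTh2009, Def 3.3 (iii) p.73] -/
theorem baseInj_ofRlfRWeak_ofGaloisActionTempered
    (tf : TemperedFrobenioid (RealifiedDivisorMonoids.ofRlfRWeak (DivisorMonoids.ofGaloisActionTempered A hZ) hpf) D VD) :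
    tf.BaseInj :=
  BaseInj.of_hBinj tf fun g => DivisorMonoids.ofGaloisActionTempered_ofRlfRWeak_hBinj A hZ hpf g

/-- **A9 ✓ and A10 ✗ simultaneously** at every tempered Frobenioid of monoid type `ℤ` over the tempered v1 data: the
injectivity law holds, the E2 root law fails (F-L2t3g5-1, p453110). [cite: MochizukiEtTh2009, Prop 4.2 (iii) p.89] -/
theorem baseInj_and_not_baseRootLaw_ofGaloisActionTempered
    (tf : TemperedFrobenioid (RealifiedDivisorMonoids.ofRlfZWeak (DivisorMonoids.ofGaloisActionTempered A hZ) hpf) D VD) :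
    tf.BaseInj ∧ ¬ tf.BaseRootLaw fun _ => True :=
  ⟨baseInj_ofRlfZWeak_ofGaloisActionTempered A hZ hpf tf, not_baseRootLaw_top_tempered A hZ hpf tf⟩

end TemperedFrobenioid

end Literature.AnabelianGeometry.EtaleTheta

end
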